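import Mathlib
import HarnessLib
import Literature.NumberTheory.EllipticCurves.BSDInvariants
import Literature.NumberTheory.EllipticCurves.RootNumber
import Literature.NumberTheory.EllipticCurves.AnalyticRank
import Literature.NumberTheory.EllipticCurves.CongruenceNumber
import Literature.NumberTheory.EllipticCurves.CuspFormLFunction

/-!
# Sketch — crux-ideate stmt-ABC-3272 (WeightedSzpiroBound), ideator 1, round 1

First-lemma signatures for the idea card `vatsal-absorption` (typed over existing declarations;
not proved here).
-/

namespace Summit.ABC.ABC.Cruxes.WeightedSzpiroBound.VatsalAbsorption

open Literature.NumberTheory.EllipticCurves.ModularForms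

/-- FIRST LEMMA (provable now, elementary): the real period of ANY integral Weierstrass model of an
elliptic curve over `ℚ` is at least `c · max(|Δ|, |c₄|³)^{-1/12}` for an absolute `c > 0`
(`|ω₁|⁴ = (2π)⁴|E₄(τ)|/|c₄|`, `|ω₁|⁶ = (2π)⁶|E₆(τ)|/|c₆|`, `E₄, E₆` have no common zero on the
fundamental domain, `c₆² ≤ |c₄|³ + 1728|Δ|`, and `Ω⁺ ≥ λ₁(Λ)`); scale-invariant, so no minimality
hypothesis is needed. -/
def PeriodHeightLowerBound : Prop :=
  ∃ c : ℝ, 0 < c ∧ ∀ W₀ : WeierstrassCurve ℤ, (W₀.baseChange ℚ).IsElliptic →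
    c * (((max |W₀.Δ| (|W₀.c₄| ^ 3) : ℤ) : ℝ)) ^ (-(1 : ℝ) / 12) ≤ (W₀.baseChange ℚ).realPeriodRat

/-- ROOT-NUMBER FREEZING (rational partners; provable from the tree's newform/Atkin–Lehner API plus
`a_p = ±1` at `p ∥ N`): two elliptic curves of the same squarefree conductor whose newforms are
congruent modulo an odd prime have the same global root number. -/
def RootNumberFreezing : Prop :=
  ∀ (N : ℕ) [NeZero N] (W W' : WeierstrassCurve ℚ) [W.IsElliptic] [W'.IsElliptic]
    (f g : CuspForm (CongruenceSubgroup.Gamma0 N) 2),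
    Squarefree N → W.conductorNorm ℤ = N → W'.conductorNorm ℤ = N →
    IsNewformOf W f → IsNewformOf W' g →
    (∃ ℓ : ℕ, ℓ.Prime ∧ ℓ ≠ 2 ∧ ∃ h ∈ integralCuspForms0 N 2, f - g = (ℓ : ℂ) • h) →
    W.rootNumber = W'.rootNumber

/-- ABSORPTION INEQUALITY (the line's key claim, stated for RATIONAL positive-rank partners; the
card's version allows irrational partners `g` through `Nm(λ)^k`). If `w(E) = +1`, `L(E,1) ≠ 0`
and the newform of `E` is congruent modulo `ℓ^k` (`ℓ ≥ 11`, `ℓ ∤ 2N`) to the newform of a curve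
`E'` of the same squarefree conductor with positive analytic rank, then
`ℓ^k ≤ C_ε · N^{1/4+ε} · max(|Δ(W₀)|, |c₄(W₀)|³)^{1/12}` for a minimal model `W₀` of `E`
(Vatsal's congruence of algebraic central values with canonical = Néron periods up to `ℓ`-units,
Manin–Drinfeld rationality with denominator `∣ 2c·#E(ℚ)_tors`, convexity for `L(E,1)`, and
`PeriodHeightLowerBound`). -/
def AbsorptionInequality : Prop :=
  ∀ ε : ℝ, 0 < ε → ∃ C : ℝ, ∀ (N : ℕ) [NeZero N] (W₀ : WeierstrassCurve ℤ) (W' : WeierstrassCurve ℚ)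
    [(W₀.baseChange ℚ).IsElliptic] [W'.IsElliptic]
    (f g : CuspForm (CongruenceSubgroup.Gamma0 N) 2) (ℓ k : ℕ),
    Squarefree N → (W₀.baseChange ℚ).conductorNorm ℤ = N → W'.conductorNorm ℤ = N →
    (∀ v : IsDedekindDomain.HeightOneSpectrum ℤ, (W₀.baseChange ℚ).IsMinimalAt v) →
    IsNewformOf (W₀.baseChange ℚ) f → IsNewformOf W' g →
    ℓ.Prime → 11 ≤ ℓ → ¬ ℓ ∣ N → 1 ≤ k →
    (∃ h ∈ integralCuspForms0 N 2, f - g = ((ℓ ^ k : ℕ) : ℂ) • h) →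
    (W₀.baseChange ℚ).rootNumber = 1 → (W₀.baseChange ℚ).entireLFunction 1 ≠ 0 →
    0 < W'.analyticRank →
    ((ℓ : ℝ) ^ k) ≤ C * (N : ℝ) ^ ((1 : ℝ) / 4 + ε) *
      (((max |W₀.Δ| (|W₀.c₄| ^ 3) : ℤ) : ℝ)) ^ ((1 : ℝ) / 12)

end Summit.ABC.ABC.Cruxes.WeightedSzpiroBound.VatsalAbsorption
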